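import Summits.QuantumFields.YangMills.Theorems.BalabanUVNodesN12FlatGramInverseTent
import Summits.QuantumFields.YangMills.Theorems.BalabanUVNodesN12FlatLinAvgCombCorrection
import Summits.QuantumFields.YangMills.Theorems.UnitScaleTiltProp8ChartHInvGeometry
import Literature.MathematicalPhysics.QuantumFieldTheory.Balaban1983to89.MatrixNorms
import HarnessLib

/-!
# BalabanUVNodes ∕ N12 — (J-b) module H12b: A RIGHT INVERSE OF THE TRUE ONE-STEP LINEARISATION `linAvg = L•Q − dλ̄` WITH AN `L`- AND VOLUME-UNIFORM bond-`ℓ²` LETTER —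
# `Σ_b ‖Y(b)‖² ≤ |n|·(6L^d∕(L²+2) + 288·d(d+2)²)·Σ_c ‖v(c)‖²`, i.e. in print's η-units (weight `L^{d−2}`, `d ≥ 2`) `ρ² ≤ |n|·(6 + 288d(d+2)²)`: [Balaban1985Variational] (46) for ONE linearised averaging step on the whole torus

Cell `pub-ymgap` (HUMAN RULINGS D-0062 ∕ D-0149), width seat `pub-ymgap-dag-n10-w1` g5 (modules H8–H12a of this session).  `--kind proof --supports stmt-QuantumFields-27364 --as helper` (K1⁹, KEY MAP v2);
count-neutral; THEOREMS ONLY (0 `def`, 0 `sorry`, 0 `instance`, 0 `notation`).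

THE CONSTRUCTION (flat background, one level `T^{(j)} → T^{(j+1)}`, matrix fields `Matrix n n ℂ` with the `L²`-operator norm of the series).  `Y₀ :=` the entrywise (real and imaginary parts of each
entry) TENT right inverse of `L•Q` of module H11 §3: `L•QY₀ = v` (the straight average acts entrywise, UST `bondAvg_comp_apply`), `Σ_b ‖Y₀ b‖² ≤ |n|·3L^d∕(L²+2)·Σ_c ‖v c‖²` (optimal per real
component; `‖A‖² ≤ Σ|A_{ii′}|² ≤ |n|‖A‖²`), and POINTWISE `‖Y₀ b‖² ≤ 2L^{−2d}·T(y)` on the bonds issuing from the block `B(y)`, `T(y) = Σ_{components, μ′} ((G′w)⟨y,μ′⟩² + (G′w)⟨y−e_μ′,μ′⟩²)`,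
`Σ_y T(y) ≤ 2L⁻²c₀⁻²·|n|·Σ_c‖v c‖²`, `c₀ = (L²+2)∕(3L^{d+2})`.  Then UST's `norm_combMean_le_of_local` (`‖λ̄_Z(y)‖ ≤ (d+2)L·a` if `‖Z‖ ≤ a` on `B(y)`'s bonds) gives
`Σ_y ‖λ̄(Y₀)(y)‖² ≤ 4(d+2)²L²·L^{−2d}·L⁻²c₀⁻²·|n|·Σ‖v‖² ≤ 36(d+2)²|n|·Σ‖v‖²` (`L^{−2d}c₀⁻² = 9L⁴∕(L²+2)² ≤ 9`), and module H12a's centre-spike comb correction `Y = Y₀ + dψ` solves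
`linAvg Y = v` with `Σ‖Y‖² ≤ 2Σ‖Y₀‖² + 8dΣ_y‖λ̄(Y₀) y‖²`.  In η-units (weight `L^{d−2}`, `d ≥ 2`): `ρ² ≤ |n|(6 + 288d(d+2)²)` — uniform in `L` and in the volume (UST's comb-free far-face inverse
`Prop7IterLinRightInverse.exists_rightInverse_iterLin`: sup-letter 1, ℓ²-letter `L^{d−1}`, `ρ² = L`).  CONTENTS (ns `…BalabanUVNodes.N12FlatLinAvgRightInverseUniform`): §1 `norm_sq_le_sum_re_sq_add_im_sq`,
`sum_norm_entry_sq_le`, `norm_entry_sq_eq`, `re_bondAvg_entry`, `im_bondAvg_entry`, `walkSum_mem_lieSU'`, `combMean_mem_lieSU'`; §2 ★★★ `exists_linAvg_rightInverse_uniform` (right inverse, ADDITIVE,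
ℝ-HOMOGENEOUS, `𝔰𝔲`-valued on `𝔰𝔲`-valued data, uniform letter).

HONEST FRAMING.  Linear algebra + lattice bookkeeping at the FLAT configuration; ONE level, whole torus, top-level true linearisation only; constants polynomial in `d` and `|n|`, not optimised;
the multi-level ∕ reading-(b) ∕ regional right inverse of print's (44)–(46) (J-C's `ρc` at `Bj M₁ Z k`) stays OPEN and crux-sized; nothing of Bałaban's asserted beyond this count; N12 ∕ N10 NOT
discharged; K1⁹ NOT closed; count-neutral (typed 28∕28 · discharged 5∕27 unmoved); one finite 𝕋⁴ programme at fixed ε — R4 closes the conditional finite-𝕋⁴ rung `BalabanLadder.UV` only; the YM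
mass gap (Clay) is NOT proved by any of this; nothing continuum ∕ ℝ⁴ ∕ OS.
-/

noncomputable section
open scoped BigOperators Matrix.Norms.L2Operator
open Finset
namespace Summit.QuantumFields.YangMills.BalabanUVNodes.N12FlatLinAvgRightInverseUniform

open Literature.MathematicalPhysics.QuantumFieldTheory.Balaban1983to89
open LatticeFieldCalculus (bondAvg)
open BlockAveragingEMLLinearised (linAvg combMean combMean_def walkSum walkSum_nil walkSum_cons)
open T4AdjointCovarianceUnitary (lieSU mem_lieSU_iff)
open Summit.QuantumFields.YangMills.Theorems.Prop7CombGauge (combMean_add)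
open B10StarCount (shift_unshift unshift_shift shiftEquiv)
open MatrixNorms (opNorm_sq_le_sum_norm_sq sum_norm_sq_col_le_opNorm_sq)
open Literature.MathematicalPhysics.QuantumFieldTheory.BalabanImbrieJaffe1984to88.BIJ85GaugeFunction5113 (exists_blockSite_eq)
open Summit.QuantumFields.YangMills.Theorems.ChartHInv (bondAvg_comp_apply norm_combMean_le_of_local combMean_real_smul)
open Summit.QuantumFields.YangMills.Theorems.Prop7FlatCurlCurl (sum_bond_eq_sum_site_dir)
open Summit.QuantumFields.YangMills.BalabanUVNodes.N12FlatGramInverseTent (exists_tent_rightInverse_smul_bondAvg)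
open Summit.QuantumFields.YangMills.BalabanUVNodes.N12FlatLinAvgCombCorrection (linAvg_combCorrected_eq sum_norm_sq_combCorrected_le)

variable {P : Params} {j : ℕ} {n : Type*} [Fintype n] [DecidableEq n]

/-! ## §1  Matrix bookkeeping: operator norm vs entries; the straight average acts entrywise -/

section Bookkeeping

/-- `‖A‖² ≤ Σ_{i,i′} ((A_{ii′}).re² + (A_{ii′}).im²)` (operator norm ≤ Hilbert–Schmidt). [folklore] -/
theorem norm_sq_le_sum_re_sq_add_im_sq (A : Matrix n n ℂ) : ‖A‖ ^ 2 ≤ ∑ i, ∑ i', ((A i i').re ^ 2 + (A i i').im ^ 2) := by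
  refine (opNorm_sq_le_sum_norm_sq A).trans (le_of_eq ?_)
  refine Finset.sum_congr rfl fun i _ => Finset.sum_congr rfl fun i' _ => ?_
  rw [Complex.sq_norm, Complex.normSq_apply]; ring

/-- `Σ_{i,i′} ‖A_{ii′}‖² ≤ |n|·‖A‖²` (each column is bounded by the operator norm). [folklore] -/
theorem sum_norm_entry_sq_le (A : Matrix n n ℂ) : ∑ i, ∑ i', ‖A i i'‖ ^ 2 ≤ Fintype.card n * ‖A‖ ^ 2 := by
  rw [Finset.sum_comm]
  calc ∑ i', ∑ i, ‖A i i'‖ ^ 2 ≤ ∑ _i' : n, ‖A‖ ^ 2 := Finset.sum_le_sum fun i' _ => sum_norm_sq_col_le_opNorm_sq A i'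
    _ = Fintype.card n * ‖A‖ ^ 2 := by rw [Finset.sum_const, Finset.card_univ, nsmul_eq_mul]

omit [Fintype n] [DecidableEq n] in
/-- `‖A_{ii′}‖² = re² + im²`. [folklore] -/
theorem norm_entry_sq_eq (A : Matrix n n ℂ) (i i' : n) : ‖A i i'‖ ^ 2 = (A i i').re ^ 2 + (A i i').im ^ 2 := by
  rw [Complex.sq_norm, Complex.normSq_apply]; ring

omit [Fintype n] [DecidableEq n] in
/-- The straight average acts ENTRYWISE, real part: `((QY)(c))_{ii′}.re = Q(b ↦ (Y b)_{ii′}.re)(c)`. [cite: Balaban1984PropagatorsI, (1.11) p.19] -/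
theorem re_bondAvg_entry (Y : PBond P j → Matrix n n ℂ) (c : PBond P (j + 1)) (i i' : n) :
    (bondAvg Y c i i').re = bondAvg (fun b => (Y b i i').re) c := by
  have h := bondAvg_comp_apply (Complex.reLm ∘ₗ Matrix.entryLinearMap ℝ ℂ i i') Y c
  simp only [LinearMap.coe_comp, Function.comp_apply, Matrix.entryLinearMap_apply, Complex.reLm_coe] at h
  exact h.symm

omit [Fintype n] [DecidableEq n] in
/-- The straight average acts ENTRYWISE, imaginary part. [cite: Balaban1984PropagatorsI, (1.11) p.19] -/
theorem im_bondAvg_entry (Y : PBond P j → Matrix n n ℂ) (c : PBond P (j + 1)) (i i' : n) :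
    (bondAvg Y c i i').im = bondAvg (fun b => (Y b i i').im) c := by
  have h := bondAvg_comp_apply (Complex.imLm ∘ₗ Matrix.entryLinearMap ℝ ℂ i i') Y c
  simp only [LinearMap.coe_comp, Function.comp_apply, Matrix.entryLinearMap_apply, Complex.imLm_coe] at h
  exact h.symm

omit [DecidableEq n] in
/-- A signed sum along a walk of `𝔰𝔲`-valued bond matrices is `𝔰𝔲`-valued (any index type `n`). [folklore] -/
theorem walkSum_mem_lieSU' {Y : PBond P j → Matrix n n ℂ} (hY : ∀ b, Y b ∈ lieSU n) :
    ∀ γ : List (T4Continuum.LStep P j), walkSum Y γ ∈ lieSU n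
  | [] => by rw [walkSum_nil]; exact Submodule.zero_mem _
  | st :: γ => by
    rw [walkSum_cons]
    refine Submodule.add_mem _ ?_ (walkSum_mem_lieSU' hY γ)
    split_ifs
    · exact hY _
    · exact Submodule.neg_mem _ (hY _)

omit [DecidableEq n] in
/-- The comb mean of an `𝔰𝔲`-valued field is `𝔰𝔲`-valued (real coefficients). [cite: Balaban1985Averaging, (62) p.28] -/
theorem combMean_mem_lieSU' {Y : PBond P j → Matrix n n ℂ} (hY : ∀ b, Y b ∈ lieSU n) (y : Site P (j + 1)) : combMean Y y ∈ lieSU n := by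
  rw [combMean_def]
  have hr : ((Fintype.card (BlockAveraging.Idx P) : ℂ))⁻¹ = ((((Fintype.card (BlockAveraging.Idx P) : ℝ))⁻¹ : ℝ) : ℂ) := by
    rw [Complex.ofReal_inv, Complex.ofReal_natCast]
  rw [hr, Complex.coe_smul]
  exact Submodule.smul_mem _ _ (Submodule.sum_mem _ fun i _ => walkSum_mem_lieSU' hY _)

end Bookkeeping

/-! ## §2  The uniform right inverse of the true one-step linearisation -/

section Main

/-- ★★★ **A RIGHT INVERSE OF `linAvg = L•Q − dλ̄` WITH AN `L`- AND VOLUME-UNIFORM bond-`ℓ²` LETTER** (`j + 1 ≤ m + K`): there is `R` with `linAvg (R v) = v` for every matrix datum `v` on the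
bonds of `T^{(j+1)}`, `R` additive and `ℝ`-homogeneous, `R v` `𝔰𝔲`-valued for `𝔰𝔲`-valued `v`, and `Σ_b ‖(R v)(b)‖² ≤ |n|·(6L^d∕(L²+2) + 288·d·(d+2)²)·Σ_c ‖v(c)‖²` —
in η-units (`d ≥ 2`) `ρ² ≤ |n|(6 + 288d(d+2)²)`.  `R v = Y₀ + dψ`: `Y₀` the entrywise tent right inverse of
`L•Q` (H11), `ψ` the centre spikes of `λ̄(Y₀)` (H12a). [cite: Balaban1985Variational, (44)-(46) p.285; Balaban1985Averaging, (124)-(125) p.36, (62) p.28] -/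
theorem exists_linAvg_rightInverse_uniform (hj : j + 1 ≤ P.m + P.K) :
    ∃ R : (PBond P (j + 1) → Matrix n n ℂ) → (PBond P j → Matrix n n ℂ),
      (∀ v c, linAvg (R v) c = v c) ∧
      (∀ v w, R (v + w) = R v + R w) ∧ (∀ (a : ℝ) v, R (a • v) = a • R v) ∧
      (∀ v, (∀ c, v c ∈ lieSU n) → ∀ b, R v b ∈ lieSU n) ∧
      ∀ v, ∑ b, ‖R v b‖ ^ 2 ≤ Fintype.card n * (6 * (P.L : ℝ) ^ P.d / ((P.L : ℝ) ^ 2 + 2) + 288 * P.d * ((P.d : ℝ) + 2) ^ 2) * ∑ c, ‖v c‖ ^ 2 := by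
  classical
  have hL : (0 : ℝ) < (P.L : ℝ) := Nat.cast_pos.mpr P.L_pos
  have hL' : (P.L : ℝ) ≠ 0 := hL.ne'
  obtain ⟨G', hG'le, hG'id, hH'le, hpt⟩ := exists_tent_rightInverse_smul_bondAvg (P := P) hj
  -- the real tent inverse and its three properties
  set Hr : (PBond P (j + 1) → ℝ) → PBond P j → ℝ := fun w b => ∑ c, bondAvg (Pi.single b (1 : ℝ)) c * G' w c with hHr
  have hF1 : ∀ (w : PBond P (j + 1) → ℝ) (c : PBond P (j + 1)), (P.L : ℝ) * bondAvg (Hr w) c = w c := fun w c => by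
    have := congrFun (hG'id w) c
    simpa [Pi.smul_apply, smul_eq_mul] using this
  have hF2 : ∀ w : PBond P (j + 1) → ℝ, ∑ b, (Hr w b) ^ 2 ≤ (3 * (P.L : ℝ) ^ P.d / ((P.L : ℝ) ^ 2 + 2)) * ∑ c, (w c) ^ 2 := fun w => hH'le w
  have hF3 : ∀ (w : PBond P (j + 1) → ℝ) (y : Site P (j + 1)) (r : Fin P.d → Fin P.L) (μ : Fin P.d),
      (Hr w ⟨Site.blockSite y r, μ⟩) ^ 2 ≤ 2 * (((P.L : ℝ) ^ P.d)⁻¹) ^ 2 * ((G' w ⟨y, μ⟩) ^ 2 + (G' w ⟨y.unshift μ, μ⟩) ^ 2) := by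
    intro w y r μ
    have h1 : |Hr w ⟨Site.blockSite y r, μ⟩| ≤ ((P.L : ℝ) ^ P.d)⁻¹ * (|G' w ⟨y, μ⟩| + |G' w ⟨y.unshift μ, μ⟩|) := hpt w y r μ
    have h2 : (Hr w ⟨Site.blockSite y r, μ⟩) ^ 2 ≤ (((P.L : ℝ) ^ P.d)⁻¹ * (|G' w ⟨y, μ⟩| + |G' w ⟨y.unshift μ, μ⟩|)) ^ 2 := by
      rw [← sq_abs (Hr w _)]; exact pow_le_pow_left₀ (abs_nonneg _) h1 2
    have h3 : (|G' w ⟨y, μ⟩| + |G' w ⟨y.unshift μ, μ⟩|) ^ 2 ≤ 2 * ((G' w ⟨y, μ⟩) ^ 2 + (G' w ⟨y.unshift μ, μ⟩) ^ 2) := by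
      rw [← sq_abs (G' w ⟨y, μ⟩), ← sq_abs (G' w ⟨y.unshift μ, μ⟩)]; nlinarith [sq_nonneg (|G' w ⟨y, μ⟩| - |G' w ⟨y.unshift μ, μ⟩|)]
    refine h2.trans ?_
    rw [mul_pow]; nlinarith [h3, sq_nonneg (((P.L : ℝ) ^ P.d)⁻¹)]
  -- `Hr` as a real-linear map (additivity, homogeneity, finite sums for free)
  let HrL : (PBond P (j + 1) → ℝ) →ₗ[ℝ] (PBond P j → ℝ) :=
    { toFun := Hr
      map_add' := fun w w' => funext fun b => by
        simp only [hHr, map_add, Pi.add_apply, mul_add, Finset.sum_add_distrib]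
      map_smul' := fun a w => funext fun b => by
        simp only [hHr, map_smul, Pi.smul_apply, smul_eq_mul, RingHom.id_apply, Finset.mul_sum, mul_left_comm] }
  have hHrL : ∀ w, HrL w = Hr w := fun _ => rfl
  have hHr_add : ∀ w w' b, Hr (w + w') b = Hr w b + Hr w' b := fun w w' b => by rw [← hHrL, map_add]; rfl
  have hHr_smul : ∀ (a : ℝ) w b, Hr (a • w) b = a * Hr w b := fun a w b => by rw [← hHrL, map_smul]; rfl
  have hHr_neg : ∀ w b, Hr (-w) b = -Hr w b := fun w b => by rw [← hHrL, map_neg]; rfl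
  have hHr_sum : ∀ (f : n → PBond P (j + 1) → ℝ) b, Hr (∑ i, f i) b = ∑ i, Hr (f i) b := fun f b => by rw [← hHrL, map_sum, Finset.sum_apply]; rfl
  have hHr_zero : ∀ b, Hr 0 b = 0 := fun b => by rw [← hHrL, map_zero]; rfl
  -- the matrix-valued straight inverse `Y₀`
  set Y₀ : (PBond P (j + 1) → Matrix n n ℂ) → PBond P j → Matrix n n ℂ := fun v b =>
    Matrix.of fun i i' => (⟨Hr (fun c => (v c i i').re) b, Hr (fun c => (v c i i').im) b⟩ : ℂ) with hY₀
  have hY₀re : ∀ v b i i', (Y₀ v b i i').re = Hr (fun c => (v c i i').re) b := fun _ _ _ _ => rfl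
  have hY₀im : ∀ v b i i', (Y₀ v b i i').im = Hr (fun c => (v c i i').im) b := fun _ _ _ _ => rfl
  -- `L•QY₀ = v`
  have hstraight : ∀ v (c : PBond P (j + 1)), ((P.L : ℕ) : ℂ) • bondAvg (Y₀ v) c = v c := by
    intro v c
    ext i i'
    rw [Matrix.smul_apply, smul_eq_mul]
    apply Complex.ext
    · rw [Complex.mul_re, Complex.natCast_re, Complex.natCast_im, zero_mul, sub_zero, re_bondAvg_entry]; simp only [hY₀re]; exact hF1 _ c
    · rw [Complex.mul_im, Complex.natCast_re, Complex.natCast_im, zero_mul, add_zero, im_bondAvg_entry]; simp only [hY₀im]; exact hF1 _ c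
  -- linearity of `Y₀`
  have hY₀_add : ∀ v w, Y₀ (v + w) = fun b => Y₀ v b + Y₀ w b := by
    intro v w; funext b; ext i i'
    apply Complex.ext
    · rw [Matrix.add_apply, Complex.add_re, hY₀re, hY₀re, hY₀re, ← hHr_add]; rfl
    · rw [Matrix.add_apply, Complex.add_im, hY₀im, hY₀im, hY₀im, ← hHr_add]; rfl
  have hY₀_smul : ∀ (a : ℝ) v, Y₀ (a • v) = fun b => a • Y₀ v b := by
    intro a v; funext b; ext i i'
    apply Complex.ext
    · rw [Matrix.smul_apply, Complex.smul_re, smul_eq_mul, hY₀re, hY₀re, ← hHr_smul]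
      congr 1; funext c; simp only [Pi.smul_apply, Matrix.smul_apply, Complex.smul_re, smul_eq_mul]
    · rw [Matrix.smul_apply, Complex.smul_im, smul_eq_mul, hY₀im, hY₀im, ← hHr_smul]
      congr 1; funext c; simp only [Pi.smul_apply, Matrix.smul_apply, Complex.smul_im, smul_eq_mul]
  -- `𝔰𝔲`-preservation of `Y₀`
  have hY₀_su : ∀ v, (∀ c, v c ∈ lieSU n) → ∀ b, Y₀ v b ∈ lieSU n := by
    intro v hv b
    rw [mem_lieSU_iff]
    refine ⟨?_, ?_⟩
    · ext i i'
      rw [Matrix.star_apply, Matrix.neg_apply]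
      have hst : ∀ c, star (v c i' i) = -(v c i i') := fun c => by
        have h := congrFun (congrFun (mem_lieSU_iff.1 (hv c)).1 i) i'; rwa [Matrix.star_apply, Matrix.neg_apply] at h
      have hre : (fun c => (v c i' i).re) = -fun c => (v c i i').re := by
        funext c; have := congrArg Complex.re (hst c); simpa using this
      have him : (fun c => (v c i' i).im) = fun c => (v c i i').im := by
        funext c; have := congrArg Complex.im (hst c); simp only [Complex.star_def, Complex.conj_im, Complex.neg_im] at this; linarith
      apply Complex.ext
      · simp only [Complex.star_def, Complex.conj_re, Complex.neg_re, hY₀re, hre, hHr_neg]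
      · simp only [Complex.star_def, Complex.conj_im, Complex.neg_im, hY₀im, him]
    · rw [Matrix.trace]
      have htr : ∀ c, ∑ i, v c i i = 0 := fun c => (mem_lieSU_iff.1 (hv c)).2
      apply Complex.ext
      · rw [Complex.re_sum, Complex.zero_re]
        simp only [Matrix.diag_apply, hY₀re]
        rw [← hHr_sum]
        have h0 : (∑ i, fun c => (v c i i).re) = 0 := by
          funext c; rw [Finset.sum_apply, Pi.zero_apply, ← Complex.re_sum, htr c, Complex.zero_re]
        rw [h0, hHr_zero]
      · rw [Complex.im_sum, Complex.zero_im]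
        simp only [Matrix.diag_apply, hY₀im]
        rw [← hHr_sum]
        have h0 : (∑ i, fun c => (v c i i).im) = 0 := by
          funext c; rw [Finset.sum_apply, Pi.zero_apply, ← Complex.im_sum, htr c, Complex.zero_im]
        rw [h0, hHr_zero]
  -- the corrected field
  set ψ : (PBond P (j + 1) → Matrix n n ℂ) → Site P j → Matrix n n ℂ := fun v x =>
    if x = emb (blockOf x) then combMean (Y₀ v) (blockOf x) else 0 with hψ
  set R : (PBond P (j + 1) → Matrix n n ℂ) → PBond P j → Matrix n n ℂ := fun v b => Y₀ v b + (ψ v b.tgt - ψ v b.src) with hR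
  have hψ_add : ∀ v w x, ψ (v + w) x = ψ v x + ψ w x := fun v w x => by
    simp only [hψ, hY₀_add]
    split_ifs
    · exact combMean_add (Y₀ v) (Y₀ w) _
    · rw [add_zero]
  have hψ_smul : ∀ (a : ℝ) v x, ψ (a • v) x = a • ψ v x := fun a v x => by
    simp only [hψ, hY₀_smul]
    split_ifs
    · exact combMean_real_smul a (Y₀ v) _
    · rw [smul_zero]
  have hψ_su : ∀ v, (∀ c, v c ∈ lieSU n) → ∀ x, ψ v x ∈ lieSU n := fun v hv x => by
    simp only [hψ]
    split_ifs
    · exact combMean_mem_lieSU' (hY₀_su v hv) _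
    · exact Submodule.zero_mem _
  refine ⟨R, fun v c => linAvg_combCorrected_eq hj (Y₀ v) v (hstraight v) c, fun v w => ?_, fun a v => ?_, fun v hv b => ?_, fun v => ?_⟩
  · funext b
    simp only [hR, Pi.add_apply, hψ_add]
    rw [show Y₀ (v + w) b = Y₀ v b + Y₀ w b from congrFun (hY₀_add v w) b]
    abel
  · funext b
    simp only [hR, Pi.smul_apply, hψ_smul, smul_add, smul_sub]
    rw [show Y₀ (a • v) b = a • Y₀ v b from congrFun (hY₀_smul a v) b]
  · exact Submodule.add_mem _ (hY₀_su v hv b) (Submodule.sub_mem _ (hψ_su v hv _) (hψ_su v hv _))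
  -- THE LETTER.  (a) the straight part
  have hA : ∑ b, ‖Y₀ v b‖ ^ 2 ≤ Fintype.card n * (3 * (P.L : ℝ) ^ P.d / ((P.L : ℝ) ^ 2 + 2)) * ∑ c, ‖v c‖ ^ 2 := by
    have h1 : ∑ b, ‖Y₀ v b‖ ^ 2 ≤ ∑ b, ∑ i, ∑ i', ((Hr (fun c => (v c i i').re) b) ^ 2 + (Hr (fun c => (v c i i').im) b) ^ 2) :=
      Finset.sum_le_sum fun b _ => by
        have := norm_sq_le_sum_re_sq_add_im_sq (Y₀ v b)
        simpa only [hY₀re, hY₀im] using this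
    have h2 : ∑ b, ∑ i, ∑ i', ((Hr (fun c => (v c i i').re) b) ^ 2 + (Hr (fun c => (v c i i').im) b) ^ 2) =
        ∑ i, ∑ i', (∑ b, (Hr (fun c => (v c i i').re) b) ^ 2 + ∑ b, (Hr (fun c => (v c i i').im) b) ^ 2) := by
      rw [Finset.sum_comm]
      refine Finset.sum_congr rfl fun i _ => ?_
      rw [Finset.sum_comm]
      refine Finset.sum_congr rfl fun i' _ => ?_
      rw [Finset.sum_add_distrib]
    have h3 : ∀ i i', ∑ b, (Hr (fun c => (v c i i').re) b) ^ 2 + ∑ b, (Hr (fun c => (v c i i').im) b) ^ 2 ≤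
        (3 * (P.L : ℝ) ^ P.d / ((P.L : ℝ) ^ 2 + 2)) * ∑ c, ‖v c i i'‖ ^ 2 := fun i i' => by
      have ha := hF2 (fun c => (v c i i').re)
      have hb := hF2 (fun c => (v c i i').im)
      have hc : ∑ c, ‖v c i i'‖ ^ 2 = ∑ c, ((v c i i').re ^ 2) + ∑ c, ((v c i i').im ^ 2) := by
        rw [← Finset.sum_add_distrib]; exact Finset.sum_congr rfl fun c _ => norm_entry_sq_eq (v c) i i'
      rw [hc, mul_add]
      exact add_le_add ha hb
    have h4 : ∑ i, ∑ i', (3 * (P.L : ℝ) ^ P.d / ((P.L : ℝ) ^ 2 + 2)) * ∑ c, ‖v c i i'‖ ^ 2 ≤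
        Fintype.card n * (3 * (P.L : ℝ) ^ P.d / ((P.L : ℝ) ^ 2 + 2)) * ∑ c, ‖v c‖ ^ 2 := by
      have h5 : ∑ i, ∑ i', (3 * (P.L : ℝ) ^ P.d / ((P.L : ℝ) ^ 2 + 2)) * ∑ c, ‖v c i i'‖ ^ 2 =
          (3 * (P.L : ℝ) ^ P.d / ((P.L : ℝ) ^ 2 + 2)) * ∑ c, ∑ i, ∑ i', ‖v c i i'‖ ^ 2 := by
        simp only [← Finset.mul_sum]
        congr 1
        exact Literature.Probability.Percolation.sum_sum_sum_comm _ _ _ _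
      rw [h5, mul_comm (Fintype.card n : ℝ), mul_assoc]
      refine mul_le_mul_of_nonneg_left ?_ (by positivity)
      rw [Finset.mul_sum]
      exact Finset.sum_le_sum fun c _ => sum_norm_entry_sq_le (v c)
    exact h1.trans (h2.le.trans ((Finset.sum_le_sum fun i _ => Finset.sum_le_sum fun i' _ => h3 i i').trans h4))
  -- (b) the comb means
  have hB : ∑ y : Site P (j + 1), ‖combMean (Y₀ v) y‖ ^ 2 ≤ Fintype.card n * (36 * ((P.d : ℝ) + 2) ^ 2) * ∑ c, ‖v c‖ ^ 2 := by
    -- the local supremum over the block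
    set T : Site P (j + 1) → ℝ := fun y => ∑ i, ∑ i', ∑ μ : Fin P.d,
      (((G' (fun c => (v c i i').re) ⟨y, μ⟩) ^ 2 + (G' (fun c => (v c i i').re) ⟨y.unshift μ, μ⟩) ^ 2) +
       ((G' (fun c => (v c i i').im) ⟨y, μ⟩) ^ 2 + (G' (fun c => (v c i i').im) ⟨y.unshift μ, μ⟩) ^ 2)) with hT
    have hT0 : ∀ y, 0 ≤ T y := fun y => Finset.sum_nonneg fun _ _ => Finset.sum_nonneg fun _ _ => Finset.sum_nonneg fun _ _ => by positivity
    have hloc : ∀ (y : Site P (j + 1)) (b : PBond P j), blockOf b.src = y → ‖Y₀ v b‖ ^ 2 ≤ 2 * (((P.L : ℝ) ^ P.d)⁻¹) ^ 2 * T y := by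
      intro y b hb
      obtain ⟨r, hr⟩ := exists_blockSite_eq hj b.src
      rw [hb] at hr
      have hbeq : b = ⟨Site.blockSite y r, b.dir⟩ := by cases b; simp only at hr ⊢; rw [hr]
      refine (norm_sq_le_sum_re_sq_add_im_sq (Y₀ v b)).trans ?_
      simp only [hY₀re, hY₀im, hT, Finset.mul_sum]
      refine Finset.sum_le_sum fun i _ => Finset.sum_le_sum fun i' _ => ?_
      set F : Fin P.d → ℝ := fun μ => (2 * (((P.L : ℝ) ^ P.d)⁻¹) ^ 2) * ((((G' (fun c => (v c i i').re) ⟨y, μ⟩) ^ 2 + (G' (fun c => (v c i i').re) ⟨y.unshift μ, μ⟩) ^ 2) +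
            ((G' (fun c => (v c i i').im) ⟨y, μ⟩) ^ 2 + (G' (fun c => (v c i i').im) ⟨y.unshift μ, μ⟩) ^ 2))) with hF
      have hμ : F b.dir ≤ ∑ μ : Fin P.d, F μ := Finset.single_le_sum (f := F) (fun μ _ => by simp only [hF]; positivity) (Finset.mem_univ b.dir)
      refine le_trans ?_ hμ
      simp only [hF]
      rw [hbeq]
      have ha := hF3 (fun c => (v c i i').re) y r b.dir
      have hb' := hF3 (fun c => (v c i i').im) y r b.dir
      simp only at ha hb' ⊢
      linarith
    have hcomb : ∀ y : Site P (j + 1), ‖combMean (Y₀ v) y‖ ^ 2 ≤ (((P.d + 2) * P.L : ℕ) : ℝ) ^ 2 * (2 * (((P.L : ℝ) ^ P.d)⁻¹) ^ 2 * T y) := by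
      intro y
      have ha0 : 0 ≤ Real.sqrt (2 * (((P.L : ℝ) ^ P.d)⁻¹) ^ 2 * T y) := Real.sqrt_nonneg _
      have h := norm_combMean_le_of_local hj (Y₀ v) y ha0 fun b hs _ => Real.le_sqrt_of_sq_le (hloc y b hs)
      have h0 : 0 ≤ ‖combMean (Y₀ v) y‖ := norm_nonneg _
      calc ‖combMean (Y₀ v) y‖ ^ 2 ≤ ((((P.d + 2) * P.L : ℕ) : ℝ) * Real.sqrt (2 * (((P.L : ℝ) ^ P.d)⁻¹) ^ 2 * T y)) ^ 2 := pow_le_pow_left₀ h0 h 2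
        _ = (((P.d + 2) * P.L : ℕ) : ℝ) ^ 2 * (2 * (((P.L : ℝ) ^ P.d)⁻¹) ^ 2 * T y) := by
            rw [mul_pow, Real.sq_sqrt (by have := hT0 y; positivity)]
    -- `Σ_y T(y)`
    have hTsum : ∑ y : Site P (j + 1), T y ≤ 2 * (((P.L : ℝ) ^ 2)⁻¹ * ((((((P.L : ℝ)) ^ 2 + 2) / (3 * (P.L : ℝ) ^ (P.d + 2))) ^ 2)⁻¹)) *
        (Fintype.card n * ∑ c, ‖v c‖ ^ 2) := by
      -- per component the two sums over `(y, μ)` are sums over coarse bonds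
      have hpair : ∀ w : PBond P (j + 1) → ℝ, ∑ y : Site P (j + 1), ∑ μ : Fin P.d, ((G' w ⟨y, μ⟩) ^ 2 + (G' w ⟨y.unshift μ, μ⟩) ^ 2) = 2 * ∑ c, (G' w c) ^ 2 := by
        intro w
        have h1 : ∑ y : Site P (j + 1), ∑ μ : Fin P.d, (G' w ⟨y, μ⟩) ^ 2 = ∑ c, (G' w c) ^ 2 := by rw [sum_bond_eq_sum_site_dir]
        have h2 : ∑ y : Site P (j + 1), ∑ μ : Fin P.d, (G' w ⟨y.unshift μ, μ⟩) ^ 2 = ∑ c, (G' w c) ^ 2 := by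
          rw [Finset.sum_comm]
          have h3 : ∀ μ : Fin P.d, ∑ y : Site P (j + 1), (G' w ⟨y.unshift μ, μ⟩) ^ 2 = ∑ y : Site P (j + 1), (G' w ⟨y, μ⟩) ^ 2 := fun μ =>
            Equiv.sum_comp (shiftEquiv μ).symm (fun y => (G' w ⟨y, μ⟩) ^ 2)
          simp only [h3]
          rw [Finset.sum_comm, sum_bond_eq_sum_site_dir]
        rw [Finset.sum_congr rfl fun y _ => Finset.sum_add_distrib, Finset.sum_add_distrib, h1, h2]; ring
      have hcompw : ∀ w : PBond P (j + 1) → ℝ, ∑ y : Site P (j + 1), ∑ μ : Fin P.d, ((G' w ⟨y, μ⟩) ^ 2 + (G' w ⟨y.unshift μ, μ⟩) ^ 2) ≤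
          2 * (((P.L : ℝ) ^ 2)⁻¹ * ((((((P.L : ℝ)) ^ 2 + 2) / (3 * (P.L : ℝ) ^ (P.d + 2))) ^ 2)⁻¹)) * ∑ c, (w c) ^ 2 := fun w => by
        rw [hpair w, mul_assoc]
        exact mul_le_mul_of_nonneg_left ((hG'le w).trans (le_of_eq (by ring))) (by norm_num)
      -- reorganise `Σ_y T y`
      have hre : ∑ y : Site P (j + 1), T y = ∑ i, ∑ i', (∑ y : Site P (j + 1), ∑ μ : Fin P.d, ((G' (fun c => (v c i i').re) ⟨y, μ⟩) ^ 2 + (G' (fun c => (v c i i').re) ⟨y.unshift μ, μ⟩) ^ 2) +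
          ∑ y : Site P (j + 1), ∑ μ : Fin P.d, ((G' (fun c => (v c i i').im) ⟨y, μ⟩) ^ 2 + (G' (fun c => (v c i i').im) ⟨y.unshift μ, μ⟩) ^ 2)) := by
        simp only [hT]
        rw [Finset.sum_comm]
        refine Finset.sum_congr rfl fun i _ => ?_
        rw [Finset.sum_comm]
        refine Finset.sum_congr rfl fun i' _ => ?_
        rw [← Finset.sum_add_distrib]
        exact Finset.sum_congr rfl fun y _ => by rw [← Finset.sum_add_distrib]
      rw [hre]
      set K : ℝ := 2 * (((P.L : ℝ) ^ 2)⁻¹ * ((((((P.L : ℝ)) ^ 2 + 2) / (3 * (P.L : ℝ) ^ (P.d + 2))) ^ 2)⁻¹)) with hK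
      have hK0 : 0 ≤ K := by positivity
      calc ∑ i, ∑ i', (∑ y : Site P (j + 1), ∑ μ : Fin P.d, ((G' (fun c => (v c i i').re) ⟨y, μ⟩) ^ 2 + (G' (fun c => (v c i i').re) ⟨y.unshift μ, μ⟩) ^ 2) +
            ∑ y : Site P (j + 1), ∑ μ : Fin P.d, ((G' (fun c => (v c i i').im) ⟨y, μ⟩) ^ 2 + (G' (fun c => (v c i i').im) ⟨y.unshift μ, μ⟩) ^ 2))
          ≤ ∑ i, ∑ i', (K * ∑ c, ((v c i i').re) ^ 2 + K * ∑ c, ((v c i i').im) ^ 2) :=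
            Finset.sum_le_sum fun i _ => Finset.sum_le_sum fun i' _ => add_le_add (hcompw _) (hcompw _)
        _ = K * ∑ c, ∑ i, ∑ i', ‖v c i i'‖ ^ 2 := by
            have e1 : ∀ i i', K * ∑ c, ((v c i i').re) ^ 2 + K * ∑ c, ((v c i i').im) ^ 2 = K * ∑ c, ‖v c i i'‖ ^ 2 := fun i i' => by
              rw [← mul_add, ← Finset.sum_add_distrib]
              congr 1
              exact Finset.sum_congr rfl fun c _ => (norm_entry_sq_eq (v c) i i').symm
            simp only [e1, ← Finset.mul_sum]
            congr 1
            exact Literature.Probability.Percolation.sum_sum_sum_comm _ _ _ _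
        _ ≤ K * (Fintype.card n * ∑ c, ‖v c‖ ^ 2) := by
            refine mul_le_mul_of_nonneg_left ?_ hK0
            rw [Finset.mul_sum]
            exact Finset.sum_le_sum fun c _ => sum_norm_entry_sq_le (v c)
    -- assemble (b)
    have hconst : (((P.d + 2) * P.L : ℕ) : ℝ) ^ 2 * (2 * (((P.L : ℝ) ^ P.d)⁻¹) ^ 2) *
        (2 * (((P.L : ℝ) ^ 2)⁻¹ * ((((((P.L : ℝ)) ^ 2 + 2) / (3 * (P.L : ℝ) ^ (P.d + 2))) ^ 2)⁻¹))) ≤ 36 * ((P.d : ℝ) + 2) ^ 2 := by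
      have h1 : (((P.d + 2) * P.L : ℕ) : ℝ) ^ 2 * (2 * (((P.L : ℝ) ^ P.d)⁻¹) ^ 2) *
          (2 * (((P.L : ℝ) ^ 2)⁻¹ * ((((((P.L : ℝ)) ^ 2 + 2) / (3 * (P.L : ℝ) ^ (P.d + 2))) ^ 2)⁻¹))) =
          36 * ((P.d : ℝ) + 2) ^ 2 * ((P.L : ℝ) ^ 4 / (((P.L : ℝ) ^ 2 + 2) ^ 2)) := by
        push_cast
        field_simp
        ring
      rw [h1]
      have h2 : (P.L : ℝ) ^ 4 / (((P.L : ℝ) ^ 2 + 2) ^ 2) ≤ 1 := by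
        rw [div_le_one (by positivity)]
        nlinarith [sq_nonneg ((P.L : ℝ) ^ 2)]
      calc 36 * ((P.d : ℝ) + 2) ^ 2 * ((P.L : ℝ) ^ 4 / (((P.L : ℝ) ^ 2 + 2) ^ 2)) ≤ 36 * ((P.d : ℝ) + 2) ^ 2 * 1 :=
            mul_le_mul_of_nonneg_left h2 (by positivity)
        _ = 36 * ((P.d : ℝ) + 2) ^ 2 := mul_one _
    calc ∑ y : Site P (j + 1), ‖combMean (Y₀ v) y‖ ^ 2 ≤ ∑ y : Site P (j + 1), (((P.d + 2) * P.L : ℕ) : ℝ) ^ 2 * (2 * (((P.L : ℝ) ^ P.d)⁻¹) ^ 2 * T y) :=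
          Finset.sum_le_sum fun y _ => hcomb y
      _ = (((P.d + 2) * P.L : ℕ) : ℝ) ^ 2 * (2 * (((P.L : ℝ) ^ P.d)⁻¹) ^ 2) * ∑ y : Site P (j + 1), T y := by
          rw [Finset.mul_sum]; exact Finset.sum_congr rfl fun y _ => by ring
      _ ≤ (((P.d + 2) * P.L : ℕ) : ℝ) ^ 2 * (2 * (((P.L : ℝ) ^ P.d)⁻¹) ^ 2) *
            (2 * (((P.L : ℝ) ^ 2)⁻¹ * ((((((P.L : ℝ)) ^ 2 + 2) / (3 * (P.L : ℝ) ^ (P.d + 2))) ^ 2)⁻¹)) * (Fintype.card n * ∑ c, ‖v c‖ ^ 2)) :=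
          mul_le_mul_of_nonneg_left hTsum (by positivity)
      _ = ((((P.d + 2) * P.L : ℕ) : ℝ) ^ 2 * (2 * (((P.L : ℝ) ^ P.d)⁻¹) ^ 2) *
            (2 * (((P.L : ℝ) ^ 2)⁻¹ * ((((((P.L : ℝ)) ^ 2 + 2) / (3 * (P.L : ℝ) ^ (P.d + 2))) ^ 2)⁻¹)))) * (Fintype.card n * ∑ c, ‖v c‖ ^ 2) := by ring
      _ ≤ (36 * ((P.d : ℝ) + 2) ^ 2) * (Fintype.card n * ∑ c, ‖v c‖ ^ 2) := mul_le_mul_of_nonneg_right hconst (by positivity)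
      _ = Fintype.card n * (36 * ((P.d : ℝ) + 2) ^ 2) * ∑ c, ‖v c‖ ^ 2 := by ring
  -- (c) total
  have hd0 : (0 : ℝ) ≤ P.d := Nat.cast_nonneg _
  calc ∑ b, ‖Y₀ v b + ((if b.tgt = emb (blockOf b.tgt) then combMean (Y₀ v) (blockOf b.tgt) else 0) -
          (if b.src = emb (blockOf b.src) then combMean (Y₀ v) (blockOf b.src) else 0))‖ ^ 2
      ≤ 2 * ∑ b, ‖Y₀ v b‖ ^ 2 + 8 * P.d * ∑ y : Site P (j + 1), ‖combMean (Y₀ v) y‖ ^ 2 := sum_norm_sq_combCorrected_le hj (Y₀ v)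
    _ ≤ 2 * (Fintype.card n * (3 * (P.L : ℝ) ^ P.d / ((P.L : ℝ) ^ 2 + 2)) * ∑ c, ‖v c‖ ^ 2) +
          8 * P.d * (Fintype.card n * (36 * ((P.d : ℝ) + 2) ^ 2) * ∑ c, ‖v c‖ ^ 2) :=
        add_le_add (mul_le_mul_of_nonneg_left hA (by norm_num)) (mul_le_mul_of_nonneg_left hB (by positivity))
    _ = Fintype.card n * (6 * (P.L : ℝ) ^ P.d / ((P.L : ℝ) ^ 2 + 2) + 288 * P.d * ((P.d : ℝ) + 2) ^ 2) * ∑ c, ‖v c‖ ^ 2 := by ring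

end Main

end Summit.QuantumFields.YangMills.BalabanUVNodes.N12FlatLinAvgRightInverseUniform
end
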